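import Summits.RiemannHypothesis.RiemannHypothesis.Theorems.GroundBartaPolarPerronFrobeniusGroundCriterion
import HarnessLib

/-!
# RiemannHypothesis / GroundBarta — crux `PolarPerronFrobenius` (stmt-RiemannHypothesis-18390):
# the ground-state source criterion, variants (complex-valued real-a.e. ground states; edge-layer form)

Helper file (`--supports stmt-RiemannHypothesis-18390`), RH-free, Mathlib + proved tree files only,
no definitions, no named facts.

`…GroundCriterion.lean` is stated for a MEASURABLE real function `u` whose complexification is a ground
state.  Ground states come out of the existence/compactness theorems as complex `L²` classes that are
real a.e.; this file removes the bookkeeping: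

* `swg_ae_nonneg_of_source_pos_complex`: for `v` with `IsWeilGroundState a v` and `Im v = 0` a.e., if
  the source of `Re v` is positive a.e. on `{Re v < 0}`, then `Re v ≥ 0` a.e. (choose a measurable
  representative, transport the a.e. hypotheses along translations);
* `swg_edgeLayerCriterion`: the card's shape (`Cruxes/PolarPerronFrobenius/Ideas/harmonic-majorant-
  edge-source.md`, `edgeLayerCriterion`): BULK SIGN (`u ≥ 0` a.e. on `|y| ≤ a − ζ`) + SOURCE POSITIVE
  a.e. on the edge layer `a − ζ < |y|` where `u < 0` ⇒ `u ≥ 0` a.e. — with no coercivity hypothesis.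

Prover B, speedrun unit `sr-gb-rung-b` (seat 2).
-/

set_option linter.dupNamespace false

noncomputable section

open Set MeasureTheory Filter Complex
open scoped Real Topology

namespace Summit.RiemannHypothesis.RiemannHypothesis.Theorems.PolarPerronFrobenius

open Literature.NumberTheory.LFunctions
open scoped ArithmeticFunction.vonMangoldt

/-- **Edge-layer form of the ground-state criterion** (the harmonic-majorant card's
`edgeLayerCriterion`, without any coercivity hypothesis): if a real measurable ground state `u` at the
window `a` is `≥ 0` a.e. on the bulk `|y| ≤ a − ζ` and its source is positive a.e. at the points of the
edge layer `a − ζ < |y|` where `u < 0`, then `u ≥ 0` a.e. [folklore] -/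
theorem swg_edgeLayerCriterion {a ζ : ℝ} (ha : 0 < a) {u : ℝ → ℝ} (hum : Measurable u)
    (hU : IsWeilGroundState a (fun x ↦ ((u x : ℝ) : ℂ)))
    (hbulk : ∀ᵐ y : ℝ, |y| ≤ a - ζ → 0 ≤ u y)
    (hlayer : ∀ᵐ y : ℝ, a - ζ < |y| → u y < 0 → 0 <
      (∫ t in Ioi (0 : ℝ), weilArchDensity t * (max (u (y + t)) 0 + max (u (y - t)) 0)) +
      (∑ n ∈ weilPrimeIndex a, (Λ n : ℝ) / Real.sqrt n *
        (max (u (y + Real.log n)) 0 + max (u (y - Real.log n)) 0)) -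
      2 * ∫ x, max (u x) 0 * Real.cosh ((x - y) / 2)) :
    ∀ᵐ y : ℝ, 0 ≤ u y := by
  refine swg_ae_nonneg_of_source_pos ha hum hU ?_
  filter_upwards [hbulk, hlayer] with y hb hl hneg
  by_cases hy : |y| ≤ a - ζ
  · exact absurd (hb hy) (not_le.2 hneg)
  · exact hl (not_le.1 hy) hneg

/-- **Complex form of the ground-state criterion.**  Let `v` be a ground state at the window `a > 0`
(`IsWeilGroundState a v`) that is real a.e. (`Im v = 0` a.e.).  If the source of `Re v` is positive a.e.
on `{Re v < 0}`, then `Re v ≥ 0` a.e. — so `v` itself witnesses `GSP a`. [folklore] -/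
theorem swg_ae_nonneg_of_source_pos_complex {a : ℝ} (ha : 0 < a) {v : ℝ → ℂ}
    (hv : IsWeilGroundState a v) (hreal : ∀ᵐ t : ℝ, (v t).im = 0)
    (hsrc : ∀ᵐ y : ℝ, (v y).re < 0 → 0 <
      (∫ t in Ioi (0 : ℝ), weilArchDensity t * (max ((v (y + t)).re) 0 + max ((v (y - t)).re) 0)) +
      (∑ n ∈ weilPrimeIndex a, (Λ n : ℝ) / Real.sqrt n *
        (max ((v (y + Real.log n)).re) 0 + max ((v (y - Real.log n)).re) 0)) -
      2 * ∫ x, max ((v x).re) 0 * Real.cosh ((x - y) / 2)) :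
    ∀ᵐ y : ℝ, 0 ≤ (v y).re := by
  -- a measurable representative
  have hvm : AEStronglyMeasurable v volume := hv.memLp.1
  set V : ℝ → ℂ := hvm.mk v with hVdef
  have hVm : Measurable V := hvm.stronglyMeasurable_mk.measurable
  have hvV : v =ᵐ[volume] V := hvm.ae_eq_mk
  set u : ℝ → ℝ := fun x ↦ (V x).re with hudef
  have hum : Measurable u := Complex.measurable_re.comp hVm
  -- `u = Re v` a.e. and `(u : ℂ) = v` a.e.
  have huv : ∀ᵐ x : ℝ, u x = (v x).re := by
    filter_upwards [hvV] with x hx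
    simp [hudef, hx]
  have hUv : (fun x ↦ ((u x : ℝ) : ℂ)) =ᵐ[volume] v := by
    filter_upwards [hvV, hreal] with x hx hr
    simp only [hudef]
    rw [← hx]
    exact Complex.ext (by simp) (by simp [hr])
  have hU : IsWeilGroundState a (fun x ↦ ((u x : ℝ) : ℂ)) := hv.congr_ae hUv.symm
  -- transport the source hypothesis
  have hp : (fun x ↦ max (u x) 0) =ᵐ[volume] fun x ↦ max ((v x).re) 0 :=
    huv.mono fun x hx ↦ by simp only [hx]
  have hshift_add : ∀ c : ℝ, ∀ᵐ y : ℝ, max (u (y + c)) 0 = max ((v (y + c)).re) 0 := fun c ↦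
    (measurePreserving_add_right volume c).quasiMeasurePreserving.ae_eq hp
  have hshift_sub : ∀ c : ℝ, ∀ᵐ y : ℝ, max (u (y - c)) 0 = max ((v (y - c)).re) 0 := fun c ↦
    (measurePreserving_sub_right volume c).quasiMeasurePreserving.ae_eq hp
  -- the archimedean source integral agrees for EVERY `y`
  have harch : ∀ y, (∫ t in Ioi (0 : ℝ), weilArchDensity t * (max (u (y + t)) 0 + max (u (y - t)) 0)) =
      ∫ t in Ioi (0 : ℝ), weilArchDensity t * (max ((v (y + t)).re) 0 + max ((v (y - t)).re) 0) := by
    intro y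
    have h1 : ∀ᵐ t : ℝ, max (u (y + t)) 0 = max ((v (y + t)).re) 0 :=
      (measurePreserving_add_left volume y).quasiMeasurePreserving.ae_eq hp
    have h2 : ∀ᵐ t : ℝ, max (u (y - t)) 0 = max ((v (y - t)).re) 0 :=
      (Measure.measurePreserving_sub_left volume y).quasiMeasurePreserving.ae_eq hp
    refine setIntegral_congr_ae measurableSet_Ioi ?_
    filter_upwards [h1, h2] with t ht1 ht2 _
    rw [ht1, ht2]
  -- the polar source integral agrees for every `y`
  have hpolar : ∀ y, (∫ x, max (u x) 0 * Real.cosh ((x - y) / 2)) =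
      ∫ x, max ((v x).re) 0 * Real.cosh ((x - y) / 2) := fun y ↦
    integral_congr_ae (hp.mono fun x hx ↦ by simp only [hx])
  -- the prime part agrees a.e. in `y` (finitely many shifts)
  have hprime : ∀ᵐ y : ℝ, ∀ n ∈ weilPrimeIndex a,
      max (u (y + Real.log n)) 0 + max (u (y - Real.log n)) 0 =
        max ((v (y + Real.log n)).re) 0 + max ((v (y - Real.log n)).re) 0 := by
    refine (eventually_all_finset (weilPrimeIndex a)).2 fun n _ ↦ ?_
    filter_upwards [hshift_add (Real.log n), hshift_sub (Real.log n)] with y h1 h2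
    rw [h1, h2]
  have hsrc' : ∀ᵐ y : ℝ, u y < 0 → 0 <
      (∫ t in Ioi (0 : ℝ), weilArchDensity t * (max (u (y + t)) 0 + max (u (y - t)) 0)) +
      (∑ n ∈ weilPrimeIndex a, (Λ n : ℝ) / Real.sqrt n *
        (max (u (y + Real.log n)) 0 + max (u (y - Real.log n)) 0)) -
      2 * ∫ x, max (u x) 0 * Real.cosh ((x - y) / 2) := by
    filter_upwards [hsrc, huv, hprime] with y hy hyu hyp hneg
    rw [harch y, hpolar y, Finset.sum_congr rfl fun n hn ↦ by rw [hyp n hn]]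
    exact hy (by rwa [hyu] at hneg)
  have h := swg_ae_nonneg_of_source_pos ha hum hU hsrc'
  filter_upwards [h, huv] with y hy hyu
  rwa [hyu] at hy

end Summit.RiemannHypothesis.RiemannHypothesis.Theorems.PolarPerronFrobenius

end
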